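import Literature.Computability.AlgebraicComplexity.DeterminantalIdealComplexityDescent
import Summits.ValiantsHypothesis.ValiantsHypothesis.Theorems.SuccinctLiftPowerBasisDescent
import Summits.ValiantsHypothesis.ValiantsHypothesis.Theorems.SuccinctLiftResidueTwo
import Summits.ValiantsHypothesis.ValiantsHypothesis.Theorems.SuccinctLiftIntegerAdvice
import Summits.ValiantsHypothesis.ValiantsHypothesis.Theorems.SuccinctLiftCharTwo

/-!
# SuccinctLift — the number-field dial for the permanent collapses below polynomial degree

Route `route-ValiantsHypothesis-SuccinctLift` (lens 2), wall D (`AlgDescentLog3`,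
stmt-ValiantsHypothesis-23721).  Corollaries of the power-basis descent
(`SuccinctLiftPowerBasisDescent.exists_circuit_of_powerBasis`) for the permanent family:

* `perEasyNF_iff_perEasyRat` — for EVERY depth profile `Δ`, per has poly-wire depth-`Δ` circuits
  over number fields `K_n ⊂ ℂ` of degree `≤ n^a + a` iff it has them over `ℚ`.
* `perEasyAlg_iff_perEasyNumberField` — the top of the dial, `PerEasyAlg Δ` (constants in
  `algebraicClosure ℚ ℂ`; its negation at `Δ = Δ₁` is wall D's conclusion), is the same statement
  with NO degree bound (the constants of one circuit generate a number field).
* `algDescentLog3_iff_perHardNumberField` — with gen 28's `algDescentLog3_iff_perHardLog3` and the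
  Lefschetz step `perEasyComplex_iff_perEasyAlg`: wall D ⟺ hardness of per at `Δ₁` over every
  number field.

Reading for wall D (honest): after gen 28 (every constant ring with an `𝔽₂`-point is excluded at
`Δ₁`) the open core of `AlgDescentLog3` is `ℚ̄`-descent; by this file it splits EXACTLY into (a) the
`ℚ`-level (invert-`2` notch, `ℤ[1/2] ⊂ ℚ`) and (b) super-polynomial growth of the degree `[K_n : ℚ]`
of the field generated by the constants — polynomial degree growth is free.  Nothing here proves
VP ≠ VNP or decides wall D.

References: Burgisser2000 (§4.1); BurgisserClausenShokrollahi1997 ((4.15));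
LimayeSrinivasanTavenas2021 (§1).
-/

noncomputable section

open MvPolynomial

-- the summit and the problem share the name `ValiantsHypothesis` (D-0017 single-conjunct layout)
set_option linter.dupNamespace false

namespace Summit.ValiantsHypothesis.ValiantsHypothesis.Theorems.SuccinctLiftNumberFieldDescent

open Literature.Computability.AlgebraicComplexity ArithCircuit
open Summit.ValiantsHypothesis.ValiantsHypothesis.Theorems.SuccinctLiftPowerBasisDescent

/-! ### The dial for the permanent: number fields of polynomial degree = the `ℚ`-level -/

section Dial

open Summit.ValiantsHypothesis.ValiantsHypothesis.Theorems.SuccinctLift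

/-- Dial point `D_ℚ`: per has `n^c+c`-wire, depth-`Δ(n)` circuits over `ℚ`.
[cite: LimayeSrinivasanTavenas2021, §1] -/
def PerEasyRat (Δ : ℕ → ℕ) : Prop :=
  ∃ c : ℕ, ∀ n : ℕ, ∃ C : ArithCircuit ℚ (Fin n × Fin n),
    C.Computes (perPoly (Fin n) ℚ) ∧ C.productDepth ≤ Δ n ∧ C.edgeSize ≤ n ^ c + c

/-- Dial point `D_NF(poly)`: per has `n^c+c`-wire, depth-`Δ(n)` circuits over number fields
`K_n ⊂ ℂ` of degree `[K_n : ℚ] ≤ n^a + a`. [cite: BurgisserClausenShokrollahi1997, (4.15)] -/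
def PerEasyNF (Δ : ℕ → ℕ) : Prop :=
  ∃ c a : ℕ, ∀ n : ℕ, ∃ K : IntermediateField ℚ ℂ, FiniteDimensional ℚ K ∧
    Module.finrank ℚ K ≤ n ^ a + a ∧ ∃ C : ArithCircuit K (Fin n × Fin n),
      C.Computes (perPoly (Fin n) K) ∧ C.productDepth ≤ Δ n ∧ C.edgeSize ≤ n ^ c + c

/-- Dial point `D_NF(∞)`: the same with NO degree bound. [cite: Burgisser2000, §4.1] -/
def PerEasyNumberField (Δ : ℕ → ℕ) : Prop :=
  ∃ c : ℕ, ∀ n : ℕ, ∃ K : IntermediateField ℚ ℂ, FiniteDimensional ℚ K ∧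
    ∃ C : ArithCircuit K (Fin n × Fin n),
      C.Computes (perPoly (Fin n) K) ∧ C.productDepth ≤ Δ n ∧ C.edgeSize ≤ n ^ c + c

/-- **The dial collapses below polynomial degree** (every depth profile `Δ`): poly-wire depth-`Δ`
circuits for per over number fields of degree `≤ n^a + a` exist iff they exist over `ℚ`
(`⇐`: `K = ℚ`; `⇒`: `exists_circuit_of_powerBasis` with the power basis of a primitive element,
`4 (n^a+a)² (n^c+c)²` wires). [cite: BurgisserClausenShokrollahi1997, (4.15)] -/
theorem perEasyNF_iff_perEasyRat (Δ : ℕ → ℕ) : PerEasyNF Δ ↔ PerEasyRat Δ := by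
  constructor
  · rintro ⟨c, a, h⟩
    obtain ⟨c', hc'⟩ : IsPBounded fun n : ℕ => 4 * (n ^ a + a) ^ 2 * (n ^ c + c) ^ 2 :=
      IsPBounded.mul_holds (IsPBounded.mul_holds (IsPBounded.const 4)
        (IsPBounded.pow_holds ⟨a, fun n => le_rfl⟩ 2)) (IsPBounded.pow_holds ⟨c, fun n => le_rfl⟩ 2)
    refine ⟨c', fun n => ?_⟩
    obtain ⟨K, hK, hdeg, C, hC, hΔ, hs⟩ := h n
    haveI := hK
    let pb : PowerBasis ℚ K := Field.powerBasisOfFiniteOfSeparable ℚ K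
    have hdim : pb.dim ≤ n ^ a + a := by rw [← pb.finrank]; exact hdeg
    obtain ⟨C', h1, h2, h3⟩ := exists_circuit_of_powerBasis pb C (perPoly (Fin n) ℚ)
      (by rw [map_perPoly]; exact hC)
    refine ⟨C', h1, h2.trans hΔ, h3.trans (le_trans ?_ (hc' n))⟩
    show 4 * pb.dim ^ 2 * C.edgeSize ^ 2 ≤ 4 * (n ^ a + a) ^ 2 * (n ^ c + c) ^ 2
    gcongr
  · rintro ⟨c, h⟩
    refine ⟨c, 1, fun n => ?_⟩
    obtain ⟨C, hC, hΔ, hs⟩ := h n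
    refine ⟨⊥, inferInstance, by rw [IntermediateField.finrank_bot]; omega, ?_⟩
    obtain ⟨D, hD, hpd, hes⟩ := SuccinctLiftResidueTwo.exists_circuit_of_ringHom'
      (algebraMap ℚ ((⊥ : IntermediateField ℚ ℂ))) C hC
    exact ⟨D, hD, hpd ▸ hΔ, hes ▸ hs⟩

/-- A circuit over `Q̄ = algebraicClosure ℚ ℂ` has its (finitely many) constants in a number field
`K ⊂ ℂ`, and is a circuit over `K` with the same skeleton computing per. [cite: Burgisser2000, §4.1] -/
theorem exists_numberField_of_algebraic {n : ℕ}
    (C : ArithCircuit (algebraicClosure ℚ ℂ) (Fin n × Fin n))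
    (hC : C.Computes (perPoly (Fin n) (algebraicClosure ℚ ℂ))) :
    ∃ K : IntermediateField ℚ ℂ, FiniteDimensional ℚ K ∧ ∃ D : ArithCircuit K (Fin n × Fin n),
      D.Computes (perPoly (Fin n) K) ∧ D.productDepth = C.productDepth ∧
        D.edgeSize = C.edgeSize := by
  classical
  let S : Set ℂ := ((C.consts.map (fun z : algebraicClosure ℚ ℂ => (z : ℂ))).toFinset : Set ℂ)
  let K : IntermediateField ℚ ℂ := IntermediateField.adjoin ℚ S
  have hSint : ∀ x ∈ S, IsIntegral ℚ x := by
    intro x hx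
    simp only [S, List.coe_toFinset, List.mem_map, Set.mem_setOf_eq] at hx
    obtain ⟨z, -, rfl⟩ := hx
    exact (mem_algebraicClosure_iff.1 z.2).isIntegral
  haveI hKfin : FiniteDimensional ℚ K := IntermediateField.finiteDimensional_adjoin hSint
  have hKle : K ≤ algebraicClosure ℚ ℂ := le_algebraicClosure ℚ ℂ K
  let φ : K →+* algebraicClosure ℚ ℂ := (IntermediateField.inclusion hKle).toRingHom
  have hφinj : Function.Injective φ := (IntermediateField.inclusion hKle).injective
  let ρ : algebraicClosure ℚ ℂ → K := fun z => if h : (z : ℂ) ∈ K then ⟨z, h⟩ else 0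
  have hfix : ∀ z ∈ C.consts, φ (ρ z) = z := by
    intro z hz
    have hzK : (z : ℂ) ∈ K := IntermediateField.subset_adjoin ℚ S (by
      simp only [S, List.coe_toFinset, List.mem_map, Set.mem_setOf_eq]
      exact ⟨z, hz, rfl⟩)
    simp only [ρ, dif_pos hzK]
    rfl
  have hmap : (C.mapConsts ρ).map φ = C := ArithCircuit.map_mapConsts_eq_self ρ φ C hfix
  refine ⟨K, hKfin, C.mapConsts ρ, ?_, ?_, ?_⟩
  · refine MvPolynomial.map_injective φ hφinj ?_
    rw [← ArithCircuit.eval_map_apply, hmap, map_perPoly]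
    exact hC
  · conv_rhs => rw [← hmap]
    exact (ArithCircuit.productDepth_mapCoeff φ _).symm
  · conv_rhs => rw [← hmap]
    exact (ArithCircuit.edgeSize_mapCoeff φ _).symm

/-- **Top of the dial = number fields of unbounded degree**: `PerEasyAlg Δ` (constants in
`algebraicClosure ℚ ℂ`; its negation at `Δ₁` is the conclusion of wall D `AlgDescentLog3`) is the
number-field statement with no degree bound. [cite: Burgisser2000, §4.1] -/
theorem perEasyAlg_iff_perEasyNumberField (Δ : ℕ → ℕ) :
    PerEasyAlg Δ ↔ PerEasyNumberField Δ := by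
  constructor
  · rintro ⟨c, h⟩
    refine ⟨c, fun n => ?_⟩
    obtain ⟨C, hC, hΔ, hs⟩ := h n
    obtain ⟨K, hK, D, hD, hpd, hes⟩ := exists_numberField_of_algebraic C hC
    exact ⟨K, hK, D, hD, hpd ▸ hΔ, hes ▸ hs⟩
  · rintro ⟨c, h⟩
    refine ⟨c, fun n => ?_⟩
    obtain ⟨K, hK, C, hC, hΔ, hs⟩ := h n
    haveI := hK
    have hKle : K ≤ algebraicClosure ℚ ℂ := le_algebraicClosure ℚ ℂ K
    obtain ⟨D, hD, hpd, hes⟩ := SuccinctLiftResidueTwo.exists_circuit_of_ringHom'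
      (IntermediateField.inclusion hKle).toRingHom C hC
    exact ⟨D, hD, hpd ▸ hΔ, hes ▸ hs⟩

/-- The three lower dial points are ordered: `D_ℚ = D_NF(poly) ⟹ D_NF(∞) = D_alg`.
[cite: Burgisser2000, §4.1] -/
theorem perEasyAlg_of_perEasyRat (Δ : ℕ → ℕ) (h : PerEasyRat Δ) : PerEasyAlg Δ := by
  rw [perEasyAlg_iff_perEasyNumberField]
  obtain ⟨c, a, hca⟩ := (perEasyNF_iff_perEasyRat Δ).2 h
  exact ⟨c, fun n => by
    obtain ⟨K, hK, -, C, hC⟩ := hca n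
    exact ⟨K, hK, C, hC⟩⟩

/-- **Reading for wall D.**  `AlgDescentLog3`'s conclusion is `¬ PerEasyAlg Δ₁`; by the two dial
theorems it is EQUIVALENT to hardness over number fields of every degree profile, and its
polynomial-degree part is exactly the `ℚ`-level `¬ PerEasyRat Δ₁`: what separates the `ℚ`-level
from wall D is super-polynomial growth of `[ℚ(constants of C_n) : ℚ]`, nothing else.
[cite: Burgisser2000, §4.1] -/
theorem algDescent_conclusion_iff :
    (¬ PerEasyAlg fun n => Nat.log 2 (Nat.log 2 (Nat.log 2 n)) + 1) ↔
      ¬ PerEasyNumberField fun n => Nat.log 2 (Nat.log 2 (Nat.log 2 n)) + 1 :=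
  not_congr (perEasyAlg_iff_perEasyNumberField _)

/-- Negated form of the collapse: hardness over number fields of polynomial degree is hardness
over `ℚ`. [cite: BurgisserClausenShokrollahi1997, (4.15)] -/
theorem perHardNF_iff_perHardRat (Δ : ℕ → ℕ) : ¬ PerEasyNF Δ ↔ ¬ PerEasyRat Δ :=
  not_congr (perEasyNF_iff_perEasyRat Δ)

/-- **Wall D restated on the number-field dial** (route `SuccinctLift`, stmt-ValiantsHypothesis-23721):
`AlgDescentLog3` is EQUIVALENT to "for every `c`, some `per_n` has no `n^c+c`-wire depth-`Δ₁(n)`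
circuit over ANY number field `K ⊂ ℂ`" (via gen 28's `algDescentLog3_iff_perHardLog3`, the
Lefschetz step `perEasyComplex_iff_perEasyAlg`, and `perEasyAlg_iff_perEasyNumberField`), while its
polynomial-degree truncation `¬ PerEasyNF Δ₁` is the `ℚ`-level `¬ PerEasyRat Δ₁`
(`perHardNF_iff_perHardRat`). [cite: Burgisser2000, §4.1] -/
theorem algDescentLog3_iff_perHardNumberField :
    Theses.SuccinctLift.AlgDescentLog3 ↔
      ¬ PerEasyNumberField fun n => Nat.log 2 (Nat.log 2 (Nat.log 2 n)) + 1 :=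
  SuccinctLiftCharTwo.algDescentLog3_iff_perHardLog3.trans
    (not_congr ((perEasyComplex_iff_perEasyAlg _).trans (perEasyAlg_iff_perEasyNumberField _)))

end Dial

end Summit.ValiantsHypothesis.ValiantsHypothesis.Theorems.SuccinctLiftNumberFieldDescent
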